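import Summits.BirchSwinnertonDyer.Rank1Residual.GaloisImage.KatoDepletedLValue
import Literature.NumberTheory.EllipticCurves.ModularSymbolsHeckeProofs
import Literature.NumberTheory.EllipticCurves.CuspFormTwistRatPlusSymbol
import Literature.NumberTheory.EllipticCurves.PAdicLFunctionMinus
import Literature.NumberTheory.EllipticCurves.RohrlichNonvanishingProofs
import HarnessLib

/-!
# Kato's zeta values: EVERY character sum of `x_{k,r}` in modular-symbol currency (PK-4a)
# (cell `b2b-bsdres`, team n1011, ROUTE-1 PORT (P-KIM); r1 R1-71 (ii) / lead R5-104 (b):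
# PK-4 = PK-4a (p02) + PK-4b (p15); file `KatoZetaValueCharacterSums`; seat p02 GEN 12)

HONEST FRAMING (cell `b2b-bsdres`, run/shared/lean/b2b/bsd-rank1-residual/, verbatim in every
file): the goal of the cell is to DELETE the COMBINATION-SHAPED residual classes of the
Birch–Swinnerton-Dyer formula for ALL analytic-rank `≤ 1` elliptic curves over `ℚ` — "full BSD
formula for every rank `≤ 1` curve in class `C`" assembled STRICTLY from published theorems — so
that the rank-`≤ 1` remainder becomes exactly the CONSTRUCTION-SHAPED classes, which are TYPED
(missing-input `Prop`s), NOT attempted. This is not "finishing BSD". Team n1011 (N10/N11; ROUTE 1,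
the PORT anatomy (P-KIM) of class X4 ∧ `p = 3`): research route on CONSTRUCTION-SHAPED classes;
prove what is provable now; no claim beyond stated classes; census output = EVIDENCE, never a
Literature fact; RESIDUAL-MAP marks UNCHANGED; nothing is booked by this file. TOOL THEOREMS ONLY:
no definition, no named fact, no instance, no `sorry`; the Kato fact `ZetaBody` enters as a
displayed HYPOTHESIS `hbody`, never asserted.

## What (r1 ROUTE-1 §53.5–53.6 K-ii, §55.6 R1-71 (ii) "PK-4a: EXACT, Kato side only,
character-sum currency, primitive reduction `χ ↦ χ₀` displayed, parity split as C5")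

`ZetaBody` C5 (`Literature/…/Kato2004/EulerSystemValues.lean`, p316481) gives the character sums of
Kato's rational value `x_{k,r} ∈ ℚ(ζ_m)`, `m = cycLevel p k r`, through an ARBITRARY entire
continuation `L_χ` of the `(m·p·A)`-DEPLETED twisted `L`-series and the periods `Ω^±_f`.  This file
removes both transcendental-looking inputs and writes EVERY character sum as `κ ×` an explicit
algebraic number — for a character `χ = changeLevel χ₀` mod `m` INDUCED from a PRIMITIVE `χ₀` mod
`n₀ ∣ m` (every `χ` is so, `χ₀ = χ.primitiveCharacter`, Mathlib `changeLevel_primitiveCharacter`):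

* ★ `charSum_eq_of_even` (`χ₀(−1) = 1`):
  `Σ_b χ(b) ι(σ_b x_{k,r}) = κ · (∏_{q ∣ m·p·A, q ∤ n₀} E_q(χ₀)) · (Σ_{a mod n₀} χ₀⁻¹(a) [a/n₀]⁺_f) / g(χ₀⁻¹)
   · R⁻_χ`,
* ★ `charSum_eq_of_odd` (`χ₀(−1) = −1`): the same with `−κ`, `[a/n₀]⁻_f` and `R⁺_χ`,

where `E_q(χ₀) = 1 − χ₀(q) a_q q⁻¹ + 𝟙_{q∤N} χ₀(q)² q⁻¹` are the removed Euler factors (p02 PK-L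
`DepletedLValue.continuation_changeLevel_one_eq`, Kato §6.2), `g(χ₀⁻¹) = Σ_a χ₀⁻¹(a) e^{2πia/n₀}` the
Gauss sum of Birch's formula (`twisted_LValue_eq_holds`, proved in the tree), `[·]^±_f` the rational
modular symbols (`ratCast_ratPlusSymbol_mul_plusPeriod`, `ratMinusSymbol_mul_minusPeriod_mul_I`:
`Ω⁺[r]⁺ = plusSymbol`, `[r]⁻Ω⁻i = minusSymbol`), and `R^∓_χ = cuspFactor f (even/odd) χ̄ c d a A d′`
Kato's four-cusp factor verbatim.  The continuation `L_χ` of C5 is instantiated in the proof by the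
tree theorem `exists_differentiable_eq_twistedLSeries_holds` (so NO continuation is a hypothesis), and
the identity theorem (inside PK-L) makes the value independent of that choice.  Corollaries:
`charSum_eq_of_isPrimitive_of_even/odd` (`n₀ = m`: no factor at the primes of `m`), and
`charSum_one_eq` (`χ = 1`: `κ · ∏_{q ∣ m·p·A} E_q · [0]⁺ · R⁻_1`, the level-`m` twin of p13's
`KatoKuriharaValue.zetaBody_value_level_one`).

With F-A (`CharSum.eq_of_forall_charSum_eq`, `charSum_zeta_eq_inv_mul_gaussSum`) and T-PKEV E-A
(`GroupRingEval.charSum_sum_coeff_smul_sigma`) these identities pin `x_{k,r}` against any explicit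
group-ring element with the same character components — the PK-4b-C step (p15; r1 D-55-3), NOT done
here.  HONEST LIMITS: nothing about the MODULAR side (F-B/F-C), no Gauss-sum level change, no
comparison after `D_r`, no lattice / integrality / unit statement, no Kolyvagin statement; the odd
clause inherits C5's sign convention caveat (n1011-lit GEN 21: `ZetaBody` pins no sign relation
between even and odd values); closes nothing; books nothing; 0 defs / 0 facts.

References: K. Kato, Astérisque 295 (2004), Thm. 6.6 (1) p. 163, §6.2 p. 161, Thm. 9.7 p. 189,
(8.1.3) p. 180, Ex. 13.3 pp. 224–225 [Kato2004Asterisque]; B. J. Birch (1971) / B. Mazur, J. Tate,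
J. Teitelbaum, Invent. Math. 84 (1986) §I.8 (8.6) [MazurTateTeitelbaum1986Invent] (Birch's formula);
design `cells/n1011/ROUTE-1.md` §53.5, §55.6 R1-71 (r1), p15 GEN 9 Q-K (cell INBOX l.1614).
-/

noncomputable section

open scoped NumberField BigOperators TensorProduct
open IsDedekindDomain NumberField WeierstrassCurve
open Complex CongruenceSubgroup

namespace Summit.BirchSwinnertonDyer.Rank1Residual.GaloisImage.ZetaValueCharSum

open Literature.NumberTheory.GaloisRepresentations Literature.NumberTheory.EllipticCurves
  Literature.NumberTheory.EllipticCurves.ModularForms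
  Literature.NumberTheory.EllipticCurves.Kato2004
  Literature.NumberTheory.EllipticCurves.Kato2004.EulerSystemValues Rat.HeightOneSpectrum

/-! ### §1 Two scalar identities: Birch's formula in rational-symbol currency -/

section Birch

variable {N : ℕ} [NeZero N] (f : CuspForm (Gamma0 N) 2) {n₀ : ℕ} [NeZero n₀]

omit [NeZero n₀] in
/-- A primitive character has a primitive inverse (same conductor). [folklore] -/
theorem isPrimitive_inv {χ₀ : DirichletCharacter ℂ n₀} (hχ₀ : χ₀.IsPrimitive) : χ₀⁻¹.IsPrimitive := by
  rw [DirichletCharacter.isPrimitive_def, DirichletCharacter.conductor_inv]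
  exact hχ₀

/-- **Birch, even, rational currency**: for a primitive `χ₀` mod `n₀` with `χ₀(−1) = 1`, a rational
newform `f` and ANY entire continuation `L₀` of `L(f, χ₀, s)`:
`L₀(1) / Ω⁺_f = (Σ_a χ₀⁻¹(a) [a/n₀]⁺_f) / g(χ₀⁻¹)`.
[cite: MazurTateTeitelbaum1986Invent, §I.8 (8.6)] -/
theorem apply_one_div_plusPeriod_eq_of_even (hf : IsNewform0 f) (hQ : coeffField f = ⊥)
    {χ₀ : DirichletCharacter ℂ n₀} (hχ₀ : χ₀.IsPrimitive) (heven : χ₀ (-1) = 1)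
    {L₀ : ℂ → ℂ} (hL₀ : Differentiable ℂ L₀)
    (hL₀s : ∀ s : ℂ, 2 < s.re → L₀ s = twistedLSeries f χ₀ s) :
    L₀ 1 / (plusPeriod f : ℂ) =
      (∑ a : ZMod n₀, χ₀⁻¹ a * ((ratPlusSymbol f ((a.val : ℚ) / n₀) : ℚ) : ℂ)) /
        gaussSum χ₀⁻¹ (ZMod.stdAddChar (N := n₀)) := by
  have hg : gaussSum χ₀⁻¹ (ZMod.stdAddChar (N := n₀)) ≠ 0 :=
    gaussSum_stdAddChar_ne_zero_of_isPrimitive (isPrimitive_inv hχ₀)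
  have hΩ : (plusPeriod f : ℂ) ≠ 0 := by exact_mod_cast (IsNewform0.plusPeriod_pos_holds hf hQ).ne'
  have hB := twisted_LValue_eq_holds f hχ₀ hL₀ hL₀s
  have heven' : χ₀⁻¹ (-1) = 1 := by
    rw [MulChar.inv_apply_eq_inv', heven, inv_one]
  rw [twistedSymbolSum_eq_sum_plusSymbol heven'] at hB
  rw [div_eq_div_iff hΩ hg, mul_comm (L₀ 1), hB, Finset.sum_mul]
  refine Finset.sum_congr rfl fun a _ => ?_
  rw [← ratCast_ratPlusSymbol_mul_plusPeriod f hf hQ]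
  ring

/-- **Birch, odd, rational currency**: for a primitive `χ₀` mod `n₀` with `χ₀(−1) = −1`, a rational
newform `f` and ANY entire continuation `L₀` of `L(f, χ₀, s)`:
`L₀(1) / (i·Ω⁻_f) = (Σ_a χ₀⁻¹(a) [a/n₀]⁻_f) / g(χ₀⁻¹)`.
[cite: MazurTateTeitelbaum1986Invent, §I.8 (8.6)] -/
theorem apply_one_div_minusPeriod_eq_of_odd (hf : IsNewform0 f) (hQ : coeffField f = ⊥)
    {χ₀ : DirichletCharacter ℂ n₀} (hχ₀ : χ₀.IsPrimitive) (hodd : χ₀ (-1) = -1)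
    {L₀ : ℂ → ℂ} (hL₀ : Differentiable ℂ L₀)
    (hL₀s : ∀ s : ℂ, 2 < s.re → L₀ s = twistedLSeries f χ₀ s) :
    L₀ 1 / (Complex.I * (minusPeriod f : ℂ)) =
      (∑ a : ZMod n₀, χ₀⁻¹ a * ((ratMinusSymbol f ((a.val : ℚ) / n₀) : ℚ) : ℂ)) /
        gaussSum χ₀⁻¹ (ZMod.stdAddChar (N := n₀)) := by
  have hg : gaussSum χ₀⁻¹ (ZMod.stdAddChar (N := n₀)) ≠ 0 :=
    gaussSum_stdAddChar_ne_zero_of_isPrimitive (isPrimitive_inv hχ₀)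
  obtain ⟨hΩ', -⟩ := IsNewform0.exists_rat_smul_minusPeriod_holds (f := f) hf hQ
  have hΩ : Complex.I * (minusPeriod f : ℂ) ≠ 0 :=
    mul_ne_zero Complex.I_ne_zero (by exact_mod_cast hΩ')
  have hB := twisted_LValue_eq_holds f hχ₀ hL₀ hL₀s
  have hodd' : χ₀⁻¹ (-1) = -1 := by
    rw [MulChar.inv_apply_eq_inv', hodd, inv_neg, inv_one]
  rw [twistedSymbolSum_eq_sum_minusSymbol hodd'] at hB
  rw [div_eq_div_iff hΩ hg, mul_comm (L₀ 1), hB, Finset.sum_mul]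
  refine Finset.sum_congr rfl fun a _ => ?_
  rw [← ratMinusSymbol_mul_minusPeriod_mul_I f hf hQ]
  ring

end Birch

/-! ### §2 Kato's character sums under `ZetaBody` -/

section Zeta

variable (W : WeierstrassCurve ℚ) [W.IsElliptic] (p : ℕ) [Fact p.Prime]
  [ContinuousSMul ℤ_[p] (W.tateModule p)] [Module.Free ℤ_[p] (W.tateModule p)]
  [Module.Finite ℤ_[p] (W.tateModule p)] {N : ℕ} [NeZero N] (f : CuspForm (Gamma0 N) 2)
  (ι : (m : ℕ) → (CyclotomicField m ℚ →+* ℂ)) (κ : ℝ)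
  (Λ : ∀ (k : ℕ) (r : Finset (HeightOneSpectrum (𝓞 ℚ))),
    H1 (tateRep W p) (cycSubgroup p k r) →ₗ[ℤ_[p]] ℚ_[p] ⊗[ℚ] CyclotomicField (cycLevel p k r) ℚ)
  (c d a : ℤ) (A : ℕ) [NeZero A]
  (z : ∀ (k : ℕ) (r : (cyclotomicLevelsRat p (badPlaces c d A N)).Ideals),
    H1 (tateRep W p) ((cyclotomicLevelsRat p (badPlaces c d A N)).level k r.1))
  (x : ∀ (k : ℕ) (r : (cyclotomicLevelsRat p (badPlaces c d A N)).Ideals),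
    CyclotomicField (cycLevel p k r.1) ℚ)

/-- **★ PK-4a, EVEN characters.**  Under `hbody : ZetaBody …`, at every level `(k, r)`
(`m = cycLevel p k r`) with Kato's guards `(cd, mA) = 1`, `dd′ ≡ 1 (A)`, for a PRIMITIVE `χ₀` mod
`n₀ ∣ m` with `χ₀(−1) = 1` and its induced character `χ = changeLevel χ₀` mod `m`:
`Σ_b χ(b) ι(σ_b x_{k,r}) = κ · (∏_{q ∣ m·p·A, q ∤ n₀} E_q(χ₀)) · (Σ_a χ₀⁻¹(a)[a/n₀]⁺ / g(χ₀⁻¹)) · R⁻_χ`.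
[cite: Kato2004Asterisque, Thm. 6.6 (1) (p. 163), §6.2 (p. 161) and Thm. 9.7 (p. 189)]
[cite: MazurTateTeitelbaum1986Invent, §I.8 (8.6)] -/
theorem charSum_eq_of_even (hbody : ZetaBody W p f ι κ Λ c d a A z x) (hf : IsNewform0 f)
    (hQ : coeffField f = ⊥) (k : ℕ) (r : (cyclotomicLevelsRat p (badPlaces c d A N)).Ideals)
    (d' : ℤ) (hcd : Int.gcd (c * d) (cycLevel p k r.1 * A) = 1) (hdd' : d * d' ≡ 1 [ZMOD (A : ℤ)])
    {n₀ : ℕ} [NeZero n₀] (hn₀ : n₀ ∣ cycLevel p k r.1) {χ₀ : DirichletCharacter ℂ n₀}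
    (hχ₀ : χ₀.IsPrimitive) (heven : χ₀ (-1) = 1) :
    charSum (cycLevel p k r.1) (ι (cycLevel p k r.1)) (DirichletCharacter.changeLevel hn₀ χ₀) (x k r) =
      (κ : ℂ) *
        ((∏ q ∈ (cycLevel p k r.1 * (p * A)).primeFactors.filter (fun q => ¬ q ∣ n₀),
            (1 - χ₀ (q : ZMod n₀) * cuspCoeff f q * (q : ℂ) ^ (-(1 : ℂ)) +
              (if q ∣ N then 0 else (q : ℂ)) * χ₀ (q : ZMod n₀) ^ 2 * ((q : ℂ) ^ (-(1 : ℂ))) ^ 2)) *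
          ((∑ b : ZMod n₀, χ₀⁻¹ b * ((ratPlusSymbol f ((b.val : ℚ) / n₀) : ℚ) : ℂ)) /
            gaussSum χ₀⁻¹ (ZMod.stdAddChar (N := n₀)))) *
        cuspFactor f true (fun j => (DirichletCharacter.changeLevel hn₀ χ₀)⁻¹
          (j : ZMod (cycLevel p k r.1))) c d a A d' := by
  haveI : NeZero (cycLevel p k r.1 * (p * A)) :=
    ⟨mul_ne_zero (NeZero.ne _) (mul_ne_zero (Fact.out : p.Prime).ne_zero (NeZero.ne A))⟩
  -- the value law C5 at the induced character, with the tree's continuation of the depleted series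
  obtain ⟨-, -, -, -, -, h5⟩ := hbody
  obtain ⟨Lχ, hLχ, hLχs⟩ := exists_differentiable_eq_twistedLSeries_holds f
    (DirichletCharacter.changeLevel (dvd_mul_right (cycLevel p k r.1) (p * A))
      (DirichletCharacter.changeLevel hn₀ χ₀))
  have hdepl : IsDepletedTwistedL f (cycLevel p k r.1) (p * A)
      (DirichletCharacter.changeLevel hn₀ χ₀) Lχ := ⟨hLχ, hLχs⟩
  have heven' : DirichletCharacter.changeLevel hn₀ χ₀ (-1) = 1 := by
    have h := DirichletCharacter.changeLevel_eq_cast_of_dvd' χ₀ hn₀ (a := -1)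
      (isCoprime_one_left.neg_left)
    push_cast at h
    rw [h, heven]
  rw [((h5 k r d' _ Lχ hcd hdd' hdepl).1 heven')]
  -- strip the Euler factors down to the primitive `χ₀` (PK-L) and apply Birch (§1)
  obtain ⟨L₀, hL₀, hL₀s⟩ := exists_differentiable_eq_twistedLSeries_holds f χ₀
  have hLχs' : ∀ s : ℂ, 2 < s.re → Lχ s = twistedLSeries f
      (DirichletCharacter.changeLevel (hn₀.trans (dvd_mul_right (cycLevel p k r.1) (p * A))) χ₀) s := by
    intro s hs
    rw [hLχs s hs, ← DirichletCharacter.changeLevel_trans]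
  rw [DepletedLValue.continuation_changeLevel_one_eq hf
      (hn₀.trans (dvd_mul_right (cycLevel p k r.1) (p * A))) χ₀ hLχ hLχs' hL₀ hL₀s,
    mul_div_assoc, apply_one_div_plusPeriod_eq_of_even f hf hQ hχ₀ heven hL₀ hL₀s]

/-- **★ PK-4a, ODD characters.**  Same setting with `χ₀(−1) = −1`:
`Σ_b χ(b) ι(σ_b x_{k,r}) = −κ · (∏_{q ∣ m·p·A, q ∤ n₀} E_q(χ₀)) · (Σ_a χ₀⁻¹(a)[a/n₀]⁻ / g(χ₀⁻¹)) · R⁺_χ`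
(C5's odd clause; its sign is the witnesses' convention — `ZetaBody` pins no relation between even
and odd values, n1011-lit GEN 21).
[cite: Kato2004Asterisque, Thm. 6.6 (1) (p. 163), §6.2 (p. 161) and Thm. 9.7 (p. 189)]
[cite: MazurTateTeitelbaum1986Invent, §I.8 (8.6)] -/
theorem charSum_eq_of_odd (hbody : ZetaBody W p f ι κ Λ c d a A z x) (hf : IsNewform0 f)
    (hQ : coeffField f = ⊥) (k : ℕ) (r : (cyclotomicLevelsRat p (badPlaces c d A N)).Ideals)
    (d' : ℤ) (hcd : Int.gcd (c * d) (cycLevel p k r.1 * A) = 1) (hdd' : d * d' ≡ 1 [ZMOD (A : ℤ)])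
    {n₀ : ℕ} [NeZero n₀] (hn₀ : n₀ ∣ cycLevel p k r.1) {χ₀ : DirichletCharacter ℂ n₀}
    (hχ₀ : χ₀.IsPrimitive) (hodd : χ₀ (-1) = -1) :
    charSum (cycLevel p k r.1) (ι (cycLevel p k r.1)) (DirichletCharacter.changeLevel hn₀ χ₀) (x k r) =
      -(κ : ℂ) *
        ((∏ q ∈ (cycLevel p k r.1 * (p * A)).primeFactors.filter (fun q => ¬ q ∣ n₀),
            (1 - χ₀ (q : ZMod n₀) * cuspCoeff f q * (q : ℂ) ^ (-(1 : ℂ)) +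
              (if q ∣ N then 0 else (q : ℂ)) * χ₀ (q : ZMod n₀) ^ 2 * ((q : ℂ) ^ (-(1 : ℂ))) ^ 2)) *
          ((∑ b : ZMod n₀, χ₀⁻¹ b * ((ratMinusSymbol f ((b.val : ℚ) / n₀) : ℚ) : ℂ)) /
            gaussSum χ₀⁻¹ (ZMod.stdAddChar (N := n₀)))) *
        cuspFactor f false (fun j => (DirichletCharacter.changeLevel hn₀ χ₀)⁻¹
          (j : ZMod (cycLevel p k r.1))) c d a A d' := by
  haveI : NeZero (cycLevel p k r.1 * (p * A)) :=
    ⟨mul_ne_zero (NeZero.ne _) (mul_ne_zero (Fact.out : p.Prime).ne_zero (NeZero.ne A))⟩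
  obtain ⟨-, -, -, -, -, h5⟩ := hbody
  obtain ⟨Lχ, hLχ, hLχs⟩ := exists_differentiable_eq_twistedLSeries_holds f
    (DirichletCharacter.changeLevel (dvd_mul_right (cycLevel p k r.1) (p * A))
      (DirichletCharacter.changeLevel hn₀ χ₀))
  have hdepl : IsDepletedTwistedL f (cycLevel p k r.1) (p * A)
      (DirichletCharacter.changeLevel hn₀ χ₀) Lχ := ⟨hLχ, hLχs⟩
  have hodd' : DirichletCharacter.changeLevel hn₀ χ₀ (-1) = -1 := by
    have h := DirichletCharacter.changeLevel_eq_cast_of_dvd' χ₀ hn₀ (a := -1)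
      (isCoprime_one_left.neg_left)
    push_cast at h
    rw [h, hodd]
  rw [((h5 k r d' _ Lχ hcd hdd' hdepl).2 hodd')]
  obtain ⟨L₀, hL₀, hL₀s⟩ := exists_differentiable_eq_twistedLSeries_holds f χ₀
  have hLχs' : ∀ s : ℂ, 2 < s.re → Lχ s = twistedLSeries f
      (DirichletCharacter.changeLevel (hn₀.trans (dvd_mul_right (cycLevel p k r.1) (p * A))) χ₀) s := by
    intro s hs
    rw [hLχs s hs, ← DirichletCharacter.changeLevel_trans]
  rw [DepletedLValue.continuation_changeLevel_one_eq hf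
      (hn₀.trans (dvd_mul_right (cycLevel p k r.1) (p * A))) χ₀ hLχ hLχs' hL₀ hL₀s,
    mul_div_assoc, apply_one_div_minusPeriod_eq_of_odd f hf hQ hχ₀ hodd hL₀ hL₀s]

/-- **PK-4a at a PRIMITIVE character mod `m`** (`n₀ = m`, `χ = χ₀`): no Euler factor at the primes of
`m` is removed — the product runs over the primes `q ∣ m·p·A` with `q ∤ m`.  Even case.
[cite: Kato2004Asterisque, Thm. 6.6 (1) (p. 163) and Thm. 9.7 (p. 189)] -/
theorem charSum_eq_of_isPrimitive_of_even (hbody : ZetaBody W p f ι κ Λ c d a A z x)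
    (hf : IsNewform0 f) (hQ : coeffField f = ⊥) (k : ℕ)
    (r : (cyclotomicLevelsRat p (badPlaces c d A N)).Ideals) (d' : ℤ)
    (hcd : Int.gcd (c * d) (cycLevel p k r.1 * A) = 1) (hdd' : d * d' ≡ 1 [ZMOD (A : ℤ)])
    {χ : DirichletCharacter ℂ (cycLevel p k r.1)} (hχ : χ.IsPrimitive) (heven : χ (-1) = 1) :
    charSum (cycLevel p k r.1) (ι (cycLevel p k r.1)) χ (x k r) =
      (κ : ℂ) *
        ((∏ q ∈ (cycLevel p k r.1 * (p * A)).primeFactors.filter (fun q => ¬ q ∣ cycLevel p k r.1),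
            (1 - χ (q : ZMod (cycLevel p k r.1)) * cuspCoeff f q * (q : ℂ) ^ (-(1 : ℂ)) +
              (if q ∣ N then 0 else (q : ℂ)) * χ (q : ZMod (cycLevel p k r.1)) ^ 2 *
                ((q : ℂ) ^ (-(1 : ℂ))) ^ 2)) *
          ((∑ b : ZMod (cycLevel p k r.1), χ⁻¹ b *
              ((ratPlusSymbol f ((b.val : ℚ) / cycLevel p k r.1) : ℚ) : ℂ)) /
            gaussSum χ⁻¹ (ZMod.stdAddChar (N := cycLevel p k r.1)))) *
        cuspFactor f true (fun j => χ⁻¹ (j : ZMod (cycLevel p k r.1))) c d a A d' := by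
  have h := charSum_eq_of_even W p f ι κ Λ c d a A z x hbody hf hQ k r d' hcd hdd' (dvd_refl _) hχ heven
  rwa [DirichletCharacter.changeLevel_self] at h

/-- **PK-4a at a PRIMITIVE character mod `m`**, odd case.
[cite: Kato2004Asterisque, Thm. 6.6 (1) (p. 163) and Thm. 9.7 (p. 189)] -/
theorem charSum_eq_of_isPrimitive_of_odd (hbody : ZetaBody W p f ι κ Λ c d a A z x)
    (hf : IsNewform0 f) (hQ : coeffField f = ⊥) (k : ℕ)
    (r : (cyclotomicLevelsRat p (badPlaces c d A N)).Ideals) (d' : ℤ)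
    (hcd : Int.gcd (c * d) (cycLevel p k r.1 * A) = 1) (hdd' : d * d' ≡ 1 [ZMOD (A : ℤ)])
    {χ : DirichletCharacter ℂ (cycLevel p k r.1)} (hχ : χ.IsPrimitive) (hodd : χ (-1) = -1) :
    charSum (cycLevel p k r.1) (ι (cycLevel p k r.1)) χ (x k r) =
      -(κ : ℂ) *
        ((∏ q ∈ (cycLevel p k r.1 * (p * A)).primeFactors.filter (fun q => ¬ q ∣ cycLevel p k r.1),
            (1 - χ (q : ZMod (cycLevel p k r.1)) * cuspCoeff f q * (q : ℂ) ^ (-(1 : ℂ)) +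
              (if q ∣ N then 0 else (q : ℂ)) * χ (q : ZMod (cycLevel p k r.1)) ^ 2 *
                ((q : ℂ) ^ (-(1 : ℂ))) ^ 2)) *
          ((∑ b : ZMod (cycLevel p k r.1), χ⁻¹ b *
              ((ratMinusSymbol f ((b.val : ℚ) / cycLevel p k r.1) : ℚ) : ℂ)) /
            gaussSum χ⁻¹ (ZMod.stdAddChar (N := cycLevel p k r.1)))) *
        cuspFactor f false (fun j => χ⁻¹ (j : ZMod (cycLevel p k r.1))) c d a A d' := by
  have h := charSum_eq_of_odd W p f ι κ Λ c d a A z x hbody hf hQ k r d' hcd hdd' (dvd_refl _) hχ hodd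
  rwa [DirichletCharacter.changeLevel_self] at h

/-- **PK-4a at the TRIVIAL character** (`n₀ = 1`, `χ₀ = 1`, even): the trivial character sum
`Σ_b ι(σ_b x_{k,r})` (the trace of `x_{k,r}`) is
`κ · (∏_{q ∣ m·p·A} (1 − a_q q⁻¹ + 𝟙_{q∤N} q⁻¹)) · [0]⁺_f · R⁻_1` — the level-`m` twin of p13's
`KatoKuriharaValue.zetaBody_value_level_one` (there `m = 1`); the cusp factor is left at the
character `1` mod `m` (its arguments `c, d, cd` are units mod `m` by the guard, where it is `1`).
[cite: Kato2004Asterisque, Thm. 6.6 (1) (p. 163) and Thm. 9.7 (p. 189)] -/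
theorem charSum_one_eq (hbody : ZetaBody W p f ι κ Λ c d a A z x) (hf : IsNewform0 f)
    (hQ : coeffField f = ⊥) (k : ℕ) (r : (cyclotomicLevelsRat p (badPlaces c d A N)).Ideals)
    (d' : ℤ) (hcd : Int.gcd (c * d) (cycLevel p k r.1 * A) = 1) (hdd' : d * d' ≡ 1 [ZMOD (A : ℤ)]) :
    charSum (cycLevel p k r.1) (ι (cycLevel p k r.1)) 1 (x k r) =
      (κ : ℂ) *
        ((∏ q ∈ (cycLevel p k r.1 * (p * A)).primeFactors,
            (1 - cuspCoeff f q * (q : ℂ) ^ (-(1 : ℂ)) +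
              (if q ∣ N then 0 else (q : ℂ)) * ((q : ℂ) ^ (-(1 : ℂ))) ^ 2)) *
          ((ratPlusSymbol f 0 : ℚ) : ℂ)) *
        cuspFactor f true (fun j => (1 : DirichletCharacter ℂ (cycLevel p k r.1))
          (j : ZMod (cycLevel p k r.1))) c d a A d' := by
  have h1 : (1 : DirichletCharacter ℂ 1).IsPrimitive := DirichletCharacter.isPrimitive_one_level_one
  have h := charSum_eq_of_even W p f ι κ Λ c d a A z x hbody hf hQ k r d' hcd hdd' (one_dvd _) h1
    (by rw [MulChar.one_apply (isUnit_one.neg)])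
  rw [DirichletCharacter.changeLevel_one] at h
  simp only [inv_one] at h
  rw [h]
  -- the Euler product: no prime divides `1`, and `1(q) = 1` on `ZMod 1`
  have hprod : (∏ q ∈ (cycLevel p k r.1 * (p * A)).primeFactors.filter (fun q => ¬ q ∣ 1),
      (1 - (1 : DirichletCharacter ℂ 1) (q : ZMod 1) * cuspCoeff f q * (q : ℂ) ^ (-(1 : ℂ)) +
        (if q ∣ N then 0 else (q : ℂ)) * (1 : DirichletCharacter ℂ 1) (q : ZMod 1) ^ 2 *
          ((q : ℂ) ^ (-(1 : ℂ))) ^ 2)) =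
      ∏ q ∈ (cycLevel p k r.1 * (p * A)).primeFactors,
        (1 - cuspCoeff f q * (q : ℂ) ^ (-(1 : ℂ)) +
          (if q ∣ N then 0 else (q : ℂ)) * ((q : ℂ) ^ (-(1 : ℂ))) ^ 2) := by
    refine Finset.prod_congr (Finset.filter_eq_self.mpr fun q hq h1q =>
      (Nat.prime_of_mem_primeFactors hq).one_lt.ne' (Nat.dvd_one.mp h1q)) fun q _ => ?_
    rw [MulChar.one_apply (isUnit_of_subsingleton _), one_mul, one_pow, mul_one]
  -- the Birch quotient at the trivial character mod 1 is `[0]⁺`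
  have hg : gaussSum (1 : DirichletCharacter ℂ 1) (ZMod.stdAddChar (N := 1)) = 1 := by
    rw [gaussSum, Finset.sum_eq_single_of_mem (0 : ZMod 1) (Finset.mem_univ _)
      (fun b _ hb => absurd (Subsingleton.elim b 0) hb), MulChar.one_apply (isUnit_of_subsingleton _),
      one_mul, AddChar.map_zero_eq_one]
  have hsum : (∑ b : ZMod 1, (1 : DirichletCharacter ℂ 1) b *
      ((ratPlusSymbol f ((b.val : ℚ) / (1 : ℕ)) : ℚ) : ℂ)) = ((ratPlusSymbol f 0 : ℚ) : ℂ) := by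
    rw [Finset.sum_eq_single_of_mem (0 : ZMod 1) (Finset.mem_univ _)
      (fun b _ hb => absurd (Subsingleton.elim b 0) hb), MulChar.one_apply (isUnit_of_subsingleton _),
      one_mul, ZMod.val_zero, Nat.cast_zero, zero_div]
  rw [hprod, hg, hsum, div_one]

end Zeta

end Summit.BirchSwinnertonDyer.Rank1Residual.GaloisImage.ZetaValueCharSum

end
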